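import Mathlib
import HarnessLib
import Summits.AtomisticToContinuum.BoseEinsteinCondensation.Theorems.HealingPivotCascadeCascadeEngine
import Summits.AtomisticToContinuum.BoseEinsteinCondensation.Theorems.ScaleConvexityFractionCalculus
import Summits.AtomisticToContinuum.BoseEinsteinCondensation.Theses.NumberPhaseSandwich

/-!
# NumberPhaseSandwich — sandwich ALGEBRA + real cascade (helpers for the item `SandwichEngine`, stmt-AtomisticToContinuum-32641)

Port of the kernel-checked engine sections of the node file `NodeNumberPhaseSandwich.lean` (decomp-a2c lens-6 g10,
0 sorry) against the gate-written route file `Theses/NumberPhaseSandwich.lean`: per-density shorthands `SatAt` /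
`FlucAt` / `WallAt` / `BookAt` / `DomAbsAt` with their definitional links to the route items, the sandwich algebra
(`card_filter_sib_le`, `sum_sum_filter_add_le`, `level_law_abstract`, `domAbsAt_of_pieces`: sibling counting ≤ 8,
interior/wall split, ENNReal division), the three-phase real cascade (`cap_steps`, `law_steps`), the absolute-law cascade
engine `hasGroundStateBEC_of_absCascade`, and `sandwichEngine : …Theses.NumberPhaseSandwich.SandwichEngine` BY NAME.
-/

noncomputable section

namespace Summit.AtomisticToContinuum.BoseEinsteinCondensation.Theorems.NumberPhaseSandwichSandwichAlgebra

open scoped BigOperators Topology Classical MeasureTheory ComplexConjugate ENNReal NNReal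
open Filter Set MeasureTheory
open Summit.AtomisticToContinuum.BoseEinsteinCondensation.Theorems.ScaleConvexityFractionCalculus
  (IsModeOn mass occupation_le_mass)
open Summit.AtomisticToContinuum.BoseEinsteinCondensation.Theorems.HealingPivotCascadeEngineCore
  (subSum subMode_isModeOn subSum_le_card subSum_ne_top subSum_zero_le_maxOccupation)
open Summit.AtomisticToContinuum.BoseEinsteinCondensation.Theorems.HealingPivotCascadeCascadeEngine
  (EscapeAt FloorAt CapAt DomAt exists_pivot escapeAt_of_hasGroundStateBEC capAt_of_hasGroundStateBEC)
open Summit.AtomisticToContinuum.BoseEinsteinCondensation.Theses.NumberPhaseSandwich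

/-! ## Per-density shorthands (NOT items) and their definitional link to the items -/

section Shorthands
open Literature.MathematicalPhysics.QuantumManyBody.BoseGas
/-- Phase saturation at one density (the tail of `PhaseSaturation`). -/
def SatAt (v : ℝ → ENNReal) (ρ : ℝ) : Prop :=
  ∃ C : ℝ, 0 < C ∧ ∃ c₀ : ℝ, 0 < c₀ ∧ ∀ᶠ N : ℕ in Filter.atTop, ∃ δ : ENNReal, 0 < δ ∧ ∀ Ψ : Literature.MathematicalPhysics.QuantumManyBody.BoseGas.TrialState N (Literature.MathematicalPhysics.QuantumManyBody.BoseGas.sideLength ρ N), Literature.MathematicalPhysics.QuantumManyBody.BoseGas.energy v Ψ ≤ Literature.MathematicalPhysics.QuantumManyBody.BoseGas.groundStateEnergy v N (Literature.MathematicalPhysics.QuantumManyBody.BoseGas.sideLength ρ N) + δ → ENNReal.ofReal (c₀ * N) ≤ Literature.MathematicalPhysics.QuantumManyBody.BoseGas.maxOccupation N Ψ.ψ ∨ ∀ K k : ℕ, 1 / Real.sqrt ρ ≤ Literature.MathematicalPhysics.QuantumManyBody.BoseGas.sideLength ρ N / 2 ^ K → Literature.MathematicalPhysics.QuantumManyBody.BoseGas.sideLength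 ρ N / 2 ^ K < 2 * (1 / Real.sqrt ρ) → 1 ≤ k → k ≤ K → ∀ c c' : Literature.MathematicalPhysics.QuantumManyBody.BoseGas.SubIdx (2 ^ k), c ≠ c' → (∀ j : Fin 3, (c j : ℕ) / 2 = (c' j : ℕ) / 2) → (∀ j : Fin 3, 1 ≤ (c j : ℕ) / 2 ∧ (c j : ℕ) / 2 + 2 ≤ 2 ^ (k - 1)) → Literature.MathematicalPhysics.QuantumManyBody.BoseGas.occupation N (fun x => Literature.MathematicalPhysics.QuantumManyBody.BoseGas.subMode (Literature.MathematicalPhysics.QuantumManyBody.BoseGas.sideLength ρ N / 2 ^ k) c x - Literature.MathematicalPhysics.QuantumManyBody.BoseGas.subMode (Literature.MathematicalPhysics.QuantumManyBody.BoseGas.sideLength ρ N / 2 ^ k) c' x) Ψ.ψ * (⨅ m : ℂ, ∫⁻ X : Literature.MathematicalPhysics.QuantumManyBody.BoseGas.Config N, (‖(∑ p : Fin N, (((∏ j : Fin 3, (Real.smoothTransition (4 * ((X p j - (Literature.MathematicalPhysics.QuantumManyBody.BoseGas.sideLength ρ N / 2 ^ k) * ((c j : ℕ) : ℝ)) / (Literature.MathematicalPhysics.QuantumManyBody.BoseGas.sideLength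 ρ N / 2 ^ k))) * Real.smoothTransition (4 * (1 - (X p j - (Literature.MathematicalPhysics.QuantumManyBody.BoseGas.sideLength ρ N / 2 ^ k) * ((c j : ℕ) : ℝ)) / (Literature.MathematicalPhysics.QuantumManyBody.BoseGas.sideLength ρ N / 2 ^ k))))) - (∏ j : Fin 3, (Real.smoothTransition (4 * ((X p j - (Literature.MathematicalPhysics.QuantumManyBody.BoseGas.sideLength ρ N / 2 ^ k) * ((c' j : ℕ) : ℝ)) / (Literature.MathematicalPhysics.QuantumManyBody.BoseGas.sideLength ρ N / 2 ^ k))) * Real.smoothTransition (4 * (1 - (X p j - (Literature.MathematicalPhysics.QuantumManyBody.BoseGas.sideLength ρ N / 2 ^ k) * ((c' j : ℕ) : ℝ)) / (Literature.MathematicalPhysics.QuantumManyBody.BoseGas.sideLength ρ N / 2 ^ k))))) : ℝ) : ℂ)) - m‖₊ : ENNReal) ^ 2 * (‖Ψ.ψ X‖₊ : ENNReal) ^ 2) ≤ ENNReal.ofReal C * (Literature.MathematicalPhysics.QuantumManyBody.BoseGas.occupation N (Literature.MathematicalPhysics.QuantumManyBody.BoseGas.subMode (Literature.MathematicalPhysics.QuantumManyBody.BoseGas.sideLength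 ρ N / 2 ^ k) c) Ψ.ψ + Literature.MathematicalPhysics.QuantumManyBody.BoseGas.occupation N (Literature.MathematicalPhysics.QuantumManyBody.BoseGas.subMode (Literature.MathematicalPhysics.QuantumManyBody.BoseGas.sideLength ρ N / 2 ^ k) c') Ψ.ψ)

/-- The fluctuation floor at one density. -/
def FlucAt (v : ℝ → ENNReal) (ρ : ℝ) : Prop :=
  ∃ c₁ : ℝ, 0 < c₁ ∧ ∃ r : ℝ, 1 < r ∧ ∃ c₀ : ℝ, 0 < c₀ ∧ ∀ᶠ N : ℕ in Filter.atTop, ∃ δ : ENNReal, 0 < δ ∧ ∀ Ψ : Literature.MathematicalPhysics.QuantumManyBody.BoseGas.TrialState N (Literature.MathematicalPhysics.QuantumManyBody.BoseGas.sideLength ρ N), Literature.MathematicalPhysics.QuantumManyBody.BoseGas.energy v Ψ ≤ Literature.MathematicalPhysics.QuantumManyBody.BoseGas.groundStateEnergy v N (Literature.MathematicalPhysics.QuantumManyBody.BoseGas.sideLength ρ N) + δ → ENNReal.ofReal (c₀ * N) ≤ Literature.MathematicalPhysics.QuantumManyBody.BoseGas.maxOccupation N Ψ.ψ ∨ ∀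 K k : ℕ, 1 / Real.sqrt ρ ≤ Literature.MathematicalPhysics.QuantumManyBody.BoseGas.sideLength ρ N / 2 ^ K → Literature.MathematicalPhysics.QuantumManyBody.BoseGas.sideLength ρ N / 2 ^ K < 2 * (1 / Real.sqrt ρ) → 1 ≤ k → k ≤ K → ∀ c c' : Literature.MathematicalPhysics.QuantumManyBody.BoseGas.SubIdx (2 ^ k), c ≠ c' → (∀ j : Fin 3, (c j : ℕ) / 2 = (c' j : ℕ) / 2) → (∀ j : Fin 3, 1 ≤ (c j : ℕ) / 2 ∧ (c j : ℕ) / 2 + 2 ≤ 2 ^ (k - 1)) → ENNReal.ofReal (c₁ * r ^ (K - k)) ≤ (⨅ m : ℂ, ∫⁻ X : Literature.MathematicalPhysics.QuantumManyBody.BoseGas.Config N, (‖(∑ p : Fin N, (((∏ j : Fin 3, (Real.smoothTransition (4 * ((X p j - (Literature.MathematicalPhysics.QuantumManyBody.BoseGas.sideLength ρ N / 2 ^ k) * ((c j : ℕ) : ℝ)) / (Literature.MathematicalPhysics.QuantumManyBody.BoseGas.sideLength ρ N / 2 ^ k))) * Real.smoothTransition (4 * (1 - (X p j - (Literature.MathematicalPhysics.QuantumManyBody.BoseGas.sideLength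 ρ N / 2 ^ k) * ((c j : ℕ) : ℝ)) / (Literature.MathematicalPhysics.QuantumManyBody.BoseGas.sideLength ρ N / 2 ^ k))))) - (∏ j : Fin 3, (Real.smoothTransition (4 * ((X p j - (Literature.MathematicalPhysics.QuantumManyBody.BoseGas.sideLength ρ N / 2 ^ k) * ((c' j : ℕ) : ℝ)) / (Literature.MathematicalPhysics.QuantumManyBody.BoseGas.sideLength ρ N / 2 ^ k))) * Real.smoothTransition (4 * (1 - (X p j - (Literature.MathematicalPhysics.QuantumManyBody.BoseGas.sideLength ρ N / 2 ^ k) * ((c' j : ℕ) : ℝ)) / (Literature.MathematicalPhysics.QuantumManyBody.BoseGas.sideLength ρ N / 2 ^ k))))) : ℝ) : ℂ)) - m‖₊ : ENNReal) ^ 2 * (‖Ψ.ψ X‖₊ : ENNReal) ^ 2)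

/-- The wall-layer mass bound at one density. -/
def WallAt (v : ℝ → ENNReal) (ρ : ℝ) : Prop :=
  ∃ A : ℝ, 0 < A ∧ ∃ q : ℝ, 0 < q ∧ q < 1 ∧ ∃ c₀ : ℝ, 0 < c₀ ∧ ∀ᶠ N : ℕ in Filter.atTop, ∃ δ : ENNReal, 0 < δ ∧ ∀ Ψ : Literature.MathematicalPhysics.QuantumManyBody.BoseGas.TrialState N (Literature.MathematicalPhysics.QuantumManyBody.BoseGas.sideLength ρ N), Literature.MathematicalPhysics.QuantumManyBody.BoseGas.energy v Ψ ≤ Literature.MathematicalPhysics.QuantumManyBody.BoseGas.groundStateEnergy v N (Literature.MathematicalPhysics.QuantumManyBody.BoseGas.sideLength ρ N) + δ → ENNReal.ofReal (c₀ * N) ≤ Literature.MathematicalPhysics.QuantumManyBody.BoseGas.maxOccupation N Ψ.ψ ∨ ∀ K k : ℕ, 1 / Real.sqrt ρ ≤ Literature.MathematicalPhysics.QuantumManyBody.BoseGas.sideLength ρ N / 2 ^ K → Literature.MathematicalPhysics.QuantumManyBody.BoseGas.sideLength ρ N / 2 ^ K < 2 * (1 / Real.sqrt ρ) → 1 ≤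 k → k ≤ K → ∑ c ∈ Finset.univ.filter (fun c : Literature.MathematicalPhysics.QuantumManyBody.BoseGas.SubIdx (2 ^ k) => ¬ (∀ j : Fin 3, 1 ≤ (c j : ℕ) / 2 ∧ (c j : ℕ) / 2 + 2 ≤ 2 ^ (k - 1))), ∫⁻ x in Literature.MathematicalPhysics.QuantumManyBody.BoseGas.subCell (Literature.MathematicalPhysics.QuantumManyBody.BoseGas.sideLength ρ N / 2 ^ k) c, Literature.MathematicalPhysics.QuantumManyBody.BoseGas.oneParticleDensity N Ψ.ψ x ≤ ENNReal.ofReal (A * q ^ k * N)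

/-- Loss bookkeeping in the boxes of side `L_N = sideLength ρ N`. -/
def BookAt (ρ : ℝ) : Prop :=
  ∀ N : ℕ, 0 < Literature.MathematicalPhysics.QuantumManyBody.BoseGas.sideLength ρ N → ∀ Ψ : Literature.MathematicalPhysics.QuantumManyBody.BoseGas.TrialState N (Literature.MathematicalPhysics.QuantumManyBody.BoseGas.sideLength ρ N), ∀ k : ℕ, 1 ≤ k → (∑ q' : Literature.MathematicalPhysics.QuantumManyBody.BoseGas.SubIdx (2 ^ k), Literature.MathematicalPhysics.QuantumManyBody.BoseGas.occupation N (Literature.MathematicalPhysics.QuantumManyBody.BoseGas.subMode (Literature.MathematicalPhysics.QuantumManyBody.BoseGas.sideLength ρ N / 2 ^ k) q') Ψ.ψ ≤ (∑ q' : Literature.MathematicalPhysics.QuantumManyBody.BoseGas.SubIdx (2 ^ (k - 1)), Literature.MathematicalPhysics.QuantumManyBody.BoseGas.occupation N (Literature.MathematicalPhysics.QuantumManyBody.BoseGas.subMode (Literature.MathematicalPhysics.QuantumManyBody.BoseGas.sideLength ρ N / 2 ^ (k - 1)) q') Ψ.ψ) + (16 : ENNReal)⁻¹ * ∑ c : Literature.MathematicalPhysics.QuantumManyBody.BoseGas.SubIdx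 (2 ^ k), ∑ c' ∈ Finset.univ.filter (fun c' : Literature.MathematicalPhysics.QuantumManyBody.BoseGas.SubIdx (2 ^ k) => c ≠ c' ∧ ∀ j : Fin 3, (c j : ℕ) / 2 = (c' j : ℕ) / 2), Literature.MathematicalPhysics.QuantumManyBody.BoseGas.occupation N (fun x => Literature.MathematicalPhysics.QuantumManyBody.BoseGas.subMode (Literature.MathematicalPhysics.QuantumManyBody.BoseGas.sideLength ρ N / 2 ^ k) c x - Literature.MathematicalPhysics.QuantumManyBody.BoseGas.subMode (Literature.MathematicalPhysics.QuantumManyBody.BoseGas.sideLength ρ N / 2 ^ k) c' x) Ψ.ψ) ∧ ∀ c c' : Literature.MathematicalPhysics.QuantumManyBody.BoseGas.SubIdx (2 ^ k), Literature.MathematicalPhysics.QuantumManyBody.BoseGas.occupation N (fun x => Literature.MathematicalPhysics.QuantumManyBody.BoseGas.subMode (Literature.MathematicalPhysics.QuantumManyBody.BoseGas.sideLength ρ N / 2 ^ k) c x - Literature.MathematicalPhysics.QuantumManyBody.BoseGas.subMode (Literature.MathematicalPhysics.QuantumManyBody.BoseGas.sideLength ρ N / 2 ^ k) c' x) Ψ.ψ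 ≤ 2 * (Literature.MathematicalPhysics.QuantumManyBody.BoseGas.occupation N (Literature.MathematicalPhysics.QuantumManyBody.BoseGas.subMode (Literature.MathematicalPhysics.QuantumManyBody.BoseGas.sideLength ρ N / 2 ^ k) c) Ψ.ψ + Literature.MathematicalPhysics.QuantumManyBody.BoseGas.occupation N (Literature.MathematicalPhysics.QuantumManyBody.BoseGas.subMode (Literature.MathematicalPhysics.QuantumManyBody.BoseGas.sideLength ρ N / 2 ^ k) c') Ψ.ψ)

/-- The ABSOLUTE two-sided law at one density: pivot-side term relative to `S_k`, box-side term relative to `N`. -/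
def DomAbsAt (v : ℝ → ENNReal) (ρ : ℝ) : Prop :=
  ∃ A₁ : ℝ, 0 < A₁ ∧ ∃ q₁ : ℝ, 0 < q₁ ∧ q₁ < 1 ∧ ∃ A₂ : ℝ, 0 < A₂ ∧ ∃ q₂ : ℝ, 0 < q₂ ∧ q₂ < 1 ∧ ∃ c₀ : ℝ, 0 < c₀ ∧
    ∀ᶠ N : ℕ in Filter.atTop, ∃ δ : ENNReal, 0 < δ ∧
      ∀ Ψ : TrialState N (sideLength ρ N), energy v Ψ ≤ groundStateEnergy v N (sideLength ρ N) + δ →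
        ENNReal.ofReal (c₀ * N) ≤ maxOccupation N Ψ.ψ ∨
          ∀ K k : ℕ, 1 / Real.sqrt ρ ≤ sideLength ρ N / 2 ^ K → sideLength ρ N / 2 ^ K < 2 * (1 / Real.sqrt ρ) →
            1 ≤ k → k ≤ K →
              subSum N (sideLength ρ N) k Ψ.ψ ≤ subSum N (sideLength ρ N) (k - 1) Ψ.ψ +
                ENNReal.ofReal (A₁ * q₁ ^ (K - k)) * subSum N (sideLength ρ N) k Ψ.ψ +
                  ENNReal.ofReal (A₂ * q₂ ^ k * N)

/-- Item `PhaseSaturation` ↔ `∀ v, … → SatAt v ρ` (definitional). -/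
theorem phaseSaturation_iff :
    PhaseSaturation ↔ ∀ v : ℝ → ENNReal, IsRepulsiveFiniteRange v →
      ∃ ρ₀ : ℝ, 0 < ρ₀ ∧ ∀ ρ : ℝ, 0 < ρ → ρ < ρ₀ → SatAt v ρ := Iff.rfl

/-- Item `FluctuationFloor` ↔ `∀ v, … → FlucAt v ρ` (definitional). -/
theorem fluctuationFloor_iff :
    FluctuationFloor ↔ ∀ v : ℝ → ENNReal, IsRepulsiveFiniteRange v →
      ∃ ρ₀ : ℝ, 0 < ρ₀ ∧ ∀ ρ : ℝ, 0 < ρ → ρ < ρ₀ → FlucAt v ρ := Iff.rfl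

/-- Item `WallLayerMass` ↔ `∀ v, … → WallAt v ρ` (definitional). -/
theorem wallLayerMass_iff :
    WallLayerMass ↔ ∀ v : ℝ → ENNReal, IsRepulsiveFiniteRange v →
      ∃ ρ₀ : ℝ, 0 < ρ₀ ∧ ∀ ρ : ℝ, 0 < ρ → ρ < ρ₀ → WallAt v ρ := Iff.rfl

/-- Item `RetentionCap` ↔ `∀ v, … → CapAt v ρ`. -/
theorem retentionCap_iff :
    RetentionCap ↔ ∀ v : ℝ → ENNReal, IsRepulsiveFiniteRange v →
      ∃ ρ₀ : ℝ, 0 < ρ₀ ∧ ∀ ρ : ℝ, 0 < ρ → ρ < ρ₀ → CapAt v ρ := Iff.rfl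

/-- Item `SandwichEngine` ↔ its shorthand form (definitional). -/
theorem sandwichEngine_iff :
    SandwichEngine ↔ ∀ v : ℝ → ENNReal, ∀ ρ : ℝ, 0 < ρ → FloorAt v ρ → CapAt v ρ → SatAt v ρ → FlucAt v ρ →
      WallAt v ρ → BookAt ρ → HasGroundStateBEC v ρ := Iff.rfl

end Shorthands

/-! ## The sandwich algebra: sibling counting and the per-level absolute law -/

section Algebra
open Literature.MathematicalPhysics.QuantumManyBody.BoseGas

/-- A sub-cell has at most `8` siblings (cells with the same parent): the parities of the three indices
determine a sibling. -/
theorem card_filter_sib_le {m : ℕ} (c : SubIdx m) :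
    (Finset.univ.filter (fun c' : SubIdx m => c ≠ c' ∧ ∀ j : Fin 3, (c j : ℕ) / 2 = (c' j : ℕ) / 2)).card ≤ 8 := by
  classical
  let par : SubIdx m → (Fin 3 → Fin 2) := fun c' j => ⟨(c' j : ℕ) % 2, Nat.mod_lt _ two_pos⟩
  have h8 : (Finset.univ : Finset (Fin 3 → Fin 2)).card = 8 := by
    rw [Finset.card_univ, Fintype.card_fun]; simp
  rw [← h8]
  refine Finset.card_le_card_of_injOn par (fun _ _ => Finset.mem_univ _) ?_
  intro a ha b hb hab
  simp only [Finset.coe_filter, Finset.mem_univ, true_and, Set.mem_setOf_eq] at ha hb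
  funext j
  apply Fin.ext
  have hpa : (a j : ℕ) % 2 = (b j : ℕ) % 2 := by
    have := congr_fun hab j
    simpa [par, Fin.ext_iff] using this
  have hda : (a j : ℕ) / 2 = (b j : ℕ) / 2 := by rw [← ha.2 j, ← hb.2 j]
  rw [← Nat.div_add_mod (a j : ℕ) 2, ← Nat.div_add_mod (b j : ℕ) 2, hpa, hda]

/-- Symmetric double sums over a relation with fibres of size `≤ 8`: `Σ_a Σ_{b ~ a} (f a + f b) ≤ 16 Σ f`. -/
theorem sum_sum_filter_add_le {ι : Type*} [Fintype ι] (P : ι → ι → Prop) [DecidableRel P]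
    (hsymm : ∀ a b, P a b → P b a) (hcard : ∀ a, (Finset.univ.filter (P a)).card ≤ 8) (f : ι → ENNReal) :
    ∑ a, ∑ b ∈ Finset.univ.filter (P a), (f a + f b) ≤ 16 * ∑ a, f a := by
  classical
  have h1 : ∑ a, ∑ b ∈ Finset.univ.filter (P a), f a ≤ 8 * ∑ a, f a := by
    rw [Finset.mul_sum]
    refine Finset.sum_le_sum fun a _ => ?_
    rw [Finset.sum_const, nsmul_eq_mul]
    gcongr
    exact_mod_cast hcard a
  have h2 : ∑ a, ∑ b ∈ Finset.univ.filter (P a), f b ≤ 8 * ∑ a, f a := by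
    have hcard' : ∀ b, (Finset.univ.filter (fun a => P a b)).card ≤ 8 := fun b => by
      have : Finset.univ.filter (fun a => P a b) = Finset.univ.filter (P b) := by
        ext a; simp only [Finset.mem_filter, Finset.mem_univ, true_and]
        exact ⟨fun h => hsymm _ _ h, fun h => hsymm _ _ h⟩
      rw [this]; exact hcard b
    calc ∑ a, ∑ b ∈ Finset.univ.filter (P a), f b
        = ∑ a, ∑ b, (if P a b then f b else 0) := Finset.sum_congr rfl fun a _ => Finset.sum_filter _ _
      _ = ∑ b, ∑ a, (if P a b then f b else 0) := Finset.sum_comm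
      _ = ∑ b, ∑ a ∈ Finset.univ.filter (fun a => P a b), f b :=
          Finset.sum_congr rfl fun b _ => (Finset.sum_filter _ _).symm
      _ ≤ ∑ b, 8 * f b := Finset.sum_le_sum fun b _ => by
          rw [Finset.sum_const, nsmul_eq_mul]
          gcongr
          exact_mod_cast hcard' b
      _ = 8 * ∑ a, f a := by rw [← Finset.mul_sum]
  calc ∑ a, ∑ b ∈ Finset.univ.filter (P a), (f a + f b)
      = (∑ a, ∑ b ∈ Finset.univ.filter (P a), f a) + ∑ a, ∑ b ∈ Finset.univ.filter (P a), f b := by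
        rw [← Finset.sum_add_distrib]
        exact Finset.sum_congr rfl fun a _ => Finset.sum_add_distrib
    _ ≤ 8 * ∑ a, f a + 8 * ∑ a, f a := add_le_add h1 h2
    _ = 16 * ∑ a, f a := by rw [← add_mul]; norm_num

/-- `ENNReal` division step of the sandwich: `d · V ≤ C·s` and `v₀ ≤ V` (`v₀ > 0` real) give `d ≤ (C/v₀)·s`. -/
theorem le_ofReal_div_mul {d V s : ENNReal} {C v₀ : ℝ} (hv₀ : 0 < v₀)
    (h1 : d * V ≤ ENNReal.ofReal C * s) (h2 : ENNReal.ofReal v₀ ≤ V) :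
    d ≤ ENNReal.ofReal (C / v₀) * s := by
  have hv : ENNReal.ofReal v₀ ≠ 0 := (ENNReal.ofReal_pos.2 hv₀).ne'
  have h3 : d * ENNReal.ofReal v₀ ≤ ENNReal.ofReal C * s := le_trans (by gcongr) h1
  have h4 : d ≤ (ENNReal.ofReal C * s) / ENNReal.ofReal v₀ :=
    (ENNReal.le_div_iff_mul_le (Or.inl hv) (Or.inl ENNReal.ofReal_ne_top)).2 h3
  calc d ≤ (ENNReal.ofReal C * s) / ENNReal.ofReal v₀ := h4
    _ = ENNReal.ofReal (C / v₀) * s := by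
        rw [ENNReal.ofReal_div_of_pos hv₀, div_eq_mul_inv, div_eq_mul_inv]; ring

/-- **The per-level absolute law from the pieces** (abstract form). `P` = «distinct sibling», `W` = «parent is
interior» (shared along `P`), `n` = flat-mode occupations, `ms` = cell masses, `dip` = dipole occupations, `V` = the
conjugate number variances; bookkeeping + saturation on interior pairs + floor on interior pairs + `n ≤ ms` + wall
mass `≤ Wm` give `S₁ ≤ S₀ + (C/v₀)·S₁ + 2·Wm`. -/
theorem level_law_abstract {ι : Type*} [Fintype ι] (P : ι → ι → Prop) [DecidableRel P] (W : ι → Prop)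
    [DecidablePred W] (hsymm : ∀ a b, P a b → P b a) (hcard : ∀ a, (Finset.univ.filter (P a)).card ≤ 8)
    (hWP : ∀ a b, P a b → W a → W b) (n ms : ι → ENNReal) (dip V : ι → ι → ENNReal) (S₀ Wm : ENNReal)
    {C v₀ : ℝ} (hv₀ : 0 < v₀)
    (hbook1 : ∑ a, n a ≤ S₀ + (16 : ENNReal)⁻¹ * ∑ a, ∑ b ∈ Finset.univ.filter (P a), dip a b)
    (hbook2 : ∀ a b, dip a b ≤ 2 * (n a + n b))
    (hsat : ∀ a b, P a b → W a → dip a b * V a b ≤ ENNReal.ofReal C * (n a + n b))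
    (hfl : ∀ a b, P a b → W a → ENNReal.ofReal v₀ ≤ V a b)
    (hmass : ∀ a, n a ≤ ms a)
    (hwall : ∑ a ∈ Finset.univ.filter (fun a => ¬ W a), ms a ≤ Wm) :
    ∑ a, n a ≤ S₀ + ENNReal.ofReal (C / v₀) * ∑ a, n a + 2 * Wm := by
  classical
  set w : ι → ENNReal := fun a => if W a then 0 else ms a with hw
  -- per-pair bound
  have hpair : ∀ a b, P a b → dip a b ≤ ENNReal.ofReal (C / v₀) * (n a + n b) + 2 * (w a + w b) := by
    intro a b hab
    by_cases ha : W a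
    · exact (le_ofReal_div_mul hv₀ (hsat a b hab ha) (hfl a b hab ha)).trans le_self_add
    · have hb : ¬ W b := fun hb => ha (hWP b a (hsymm a b hab) hb)
      have hwa : w a = ms a := by simp [hw, ha]
      have hwb : w b = ms b := by simp [hw, hb]
      calc dip a b ≤ 2 * (n a + n b) := hbook2 a b
        _ ≤ 2 * (w a + w b) := by rw [hwa, hwb]; gcongr <;> exact hmass _
        _ ≤ _ := le_add_self
  -- sum of the per-pair bounds
  have hsum : ∑ a, ∑ b ∈ Finset.univ.filter (P a), dip a b ≤
      ENNReal.ofReal (C / v₀) * (16 * ∑ a, n a) + 2 * (16 * ∑ a, w a) := by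
    calc ∑ a, ∑ b ∈ Finset.univ.filter (P a), dip a b
        ≤ ∑ a, ∑ b ∈ Finset.univ.filter (P a), (ENNReal.ofReal (C / v₀) * (n a + n b) + 2 * (w a + w b)) :=
          Finset.sum_le_sum fun a _ => Finset.sum_le_sum fun b hb =>
            hpair a b (by simpa using hb)
      _ = ENNReal.ofReal (C / v₀) * ∑ a, ∑ b ∈ Finset.univ.filter (P a), (n a + n b) +
            2 * ∑ a, ∑ b ∈ Finset.univ.filter (P a), (w a + w b) := by
          rw [Finset.mul_sum, Finset.mul_sum, ← Finset.sum_add_distrib]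
          refine Finset.sum_congr rfl fun a _ => ?_
          rw [Finset.mul_sum, Finset.mul_sum, ← Finset.sum_add_distrib]
      _ ≤ ENNReal.ofReal (C / v₀) * (16 * ∑ a, n a) + 2 * (16 * ∑ a, w a) := by
          gcongr
          · exact sum_sum_filter_add_le P hsymm hcard n
          · exact sum_sum_filter_add_le P hsymm hcard w
  have hwsum : ∑ a, w a ≤ Wm := by
    have : ∑ a, w a = ∑ a ∈ Finset.univ.filter (fun a => ¬ W a), ms a := by
      rw [Finset.sum_filter]
      exact Finset.sum_congr rfl fun a _ => by simp only [hw]; split_ifs <;> simp_all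
    rw [this]; exact hwall
  have h16 : (16 : ENNReal)⁻¹ * 16 = 1 := ENNReal.inv_mul_cancel (by norm_num) (by norm_num)
  calc ∑ a, n a ≤ S₀ + (16 : ENNReal)⁻¹ * ∑ a, ∑ b ∈ Finset.univ.filter (P a), dip a b := hbook1
    _ ≤ S₀ + (16 : ENNReal)⁻¹ * (ENNReal.ofReal (C / v₀) * (16 * ∑ a, n a) + 2 * (16 * ∑ a, w a)) := by
        gcongr
    _ = S₀ + ENNReal.ofReal (C / v₀) * ∑ a, n a + 2 * ∑ a, w a := by
        have e1 : (16 : ENNReal)⁻¹ * (ENNReal.ofReal (C / v₀) * (16 * ∑ a, n a)) =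
            ENNReal.ofReal (C / v₀) * ∑ a, n a := by
          calc (16 : ENNReal)⁻¹ * (ENNReal.ofReal (C / v₀) * (16 * ∑ a, n a))
              = ((16 : ENNReal)⁻¹ * 16) * (ENNReal.ofReal (C / v₀) * ∑ a, n a) := by ring
            _ = _ := by rw [h16, one_mul]
        have e2 : (16 : ENNReal)⁻¹ * (2 * (16 * ∑ a, w a)) = 2 * ∑ a, w a := by
          calc (16 : ENNReal)⁻¹ * (2 * (16 * ∑ a, w a)) = ((16 : ENNReal)⁻¹ * 16) * (2 * ∑ a, w a) := by ring
            _ = _ := by rw [h16, one_mul]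
        rw [mul_add, e1, e2, add_assoc]
    _ ≤ S₀ + ENNReal.ofReal (C / v₀) * ∑ a, n a + 2 * Wm := by gcongr

/-- **THE SANDWICH** (kernel): phase saturation ∧ fluctuation floor ∧ wall-layer mass ∧ bookkeeping at one density
⇒ the absolute two-sided law at that density. -/
theorem domAbsAt_of_pieces {v : ℝ → ENNReal} {ρ : ℝ} (hρ : 0 < ρ) (hS : SatAt v ρ) (hF : FlucAt v ρ)
    (hW : WallAt v ρ) (hB : BookAt ρ) : DomAbsAt v ρ := by
  obtain ⟨C, hC, c₁, hc₁, HS⟩ := hS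
  obtain ⟨cf, hcf, r, hr, c₂, hc₂, HF⟩ := hF
  obtain ⟨A, hA, q, hq0, hq1, c₃, hc₃, HW⟩ := hW
  have hr0 : 0 < r := lt_trans one_pos hr
  refine ⟨C / cf, div_pos hC hcf, 1 / r, by positivity, (div_lt_one hr0).2 hr, 2 * A, by positivity, q, hq0, hq1,
    min (min c₁ c₂) c₃, lt_min (lt_min hc₁ hc₂) hc₃, ?_⟩
  filter_upwards [HS, HF, HW, Filter.eventually_gt_atTop 0] with N hSN hFN hWN hNpos
  obtain ⟨δ₁, hδ₁, H₁⟩ := hSN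
  obtain ⟨δ₂, hδ₂, H₂⟩ := hFN
  obtain ⟨δ₃, hδ₃, H₃⟩ := hWN
  set L := sideLength ρ N with hLdef
  have hL : 0 < L := sideLength_pos_of_pos hρ hNpos
  have hNr : (0 : ℝ) < N := by exact_mod_cast hNpos
  refine ⟨min (min δ₁ δ₂) δ₃, lt_min (lt_min hδ₁ hδ₂) hδ₃, fun Ψ hΨ => ?_⟩
  have hΨ₁ : energy v Ψ ≤ groundStateEnergy v N L + δ₁ :=
    hΨ.trans (add_le_add le_rfl ((min_le_left _ _).trans (min_le_left _ _)))
  have hΨ₂ : energy v Ψ ≤ groundStateEnergy v N L + δ₂ :=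
    hΨ.trans (add_le_add le_rfl ((min_le_left _ _).trans (min_le_right _ _)))
  have hΨ₃ : energy v Ψ ≤ groundStateEnergy v N L + δ₃ := hΨ.trans (add_le_add le_rfl (min_le_right _ _))
  have finish : ∀ c' : ℝ, min (min c₁ c₂) c₃ ≤ c' → ENNReal.ofReal (c' * N) ≤ maxOccupation N Ψ.ψ →
      ENNReal.ofReal (min (min c₁ c₂) c₃ * N) ≤ maxOccupation N Ψ.ψ := fun c' hcc' h =>
    (ENNReal.ofReal_le_ofReal (mul_le_mul_of_nonneg_right hcc' hNr.le)).trans h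
  rcases H₁ Ψ hΨ₁ with hesc | hsat
  · exact Or.inl (finish c₁ ((min_le_left _ _).trans (min_le_left _ _)) hesc)
  rcases H₂ Ψ hΨ₂ with hesc | hfl
  · exact Or.inl (finish c₂ ((min_le_left _ _).trans (min_le_right _ _)) hesc)
  rcases H₃ Ψ hΨ₃ with hesc | hwall
  · exact Or.inl (finish c₃ (min_le_right _ _) hesc)
  refine Or.inr fun K k hK1 hK2 hk1 hkK => ?_
  obtain ⟨hbook1, hbook2⟩ := hB N hL Ψ k hk1
  have hsatk := hsat K k hK1 hK2 hk1 hkK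
  have hflk := hfl K k hK1 hK2 hk1 hkK
  have hwallk := hwall K k hK1 hK2 hk1 hkK
  have hℓ : 0 < L / 2 ^ k := by positivity
  have hΨm : Measurable Ψ.ψ := Ψ.contDiff.continuous.measurable
  have hv₀ : 0 < cf * r ^ (K - k) := by positivity
  -- the abstract level law, instantiated
  have key := level_law_abstract
    (P := fun c c' : SubIdx (2 ^ k) => c ≠ c' ∧ ∀ j : Fin 3, (c j : ℕ) / 2 = (c' j : ℕ) / 2)
    (W := fun c : SubIdx (2 ^ k) => ∀ j : Fin 3, 1 ≤ (c j : ℕ) / 2 ∧ (c j : ℕ) / 2 + 2 ≤ 2 ^ (k - 1))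
    (fun a b h => ⟨fun e => h.1 e.symm, fun j => (h.2 j).symm⟩) card_filter_sib_le
    (fun a b h hW j => by rw [← h.2 j]; exact hW j)
    (fun c => occupation N (subMode (L / 2 ^ k) c) Ψ.ψ)
    (fun c => ∫⁻ x in subCell (L / 2 ^ k) c, oneParticleDensity N Ψ.ψ x)
    (fun c c' => occupation N (fun x => subMode (L / 2 ^ k) c x - subMode (L / 2 ^ k) c' x) Ψ.ψ)
    _ (subSum N L (k - 1) Ψ.ψ) (ENNReal.ofReal (A * q ^ k * N)) hv₀ hbook1 hbook2
    (fun a b hab hWa => hsatk a b hab.1 hab.2 hWa) (fun a b hab hWa => hflk a b hab.1 hab.2 hWa)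
    (fun c => occupation_le_mass (measurableSet_subCell _ c) hΨm (subMode_isModeOn hℓ c)) hwallk
  -- constants
  have e1 : C / (cf * r ^ (K - k)) = C / cf * (1 / r) ^ (K - k) := by
    rw [one_div, inv_pow, div_mul_eq_div_div, div_eq_mul_inv _ (r ^ (K - k))]
  have e2 : (2 : ENNReal) * ENNReal.ofReal (A * q ^ k * N) = ENNReal.ofReal (2 * A * q ^ k * N) := by
    rw [show (2 : ENNReal) = ENNReal.ofReal 2 by simp, ← ENNReal.ofReal_mul (by norm_num : (0:ℝ) ≤ 2)]
    ring_nf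
  rw [e1, e2] at key
  exact key

end Algebra
/-! ## The three-phase real cascade -/

section RealCascade

/-- CAP PHASE: `m` cap steps down from level `hi`, as long as the guard `θ` stays below the running bound. -/
theorem cap_steps {a : ℕ → ℝ} {x θ b : ℝ} {K hi : ℕ} (hx0 : 0 ≤ x) (hx1 : x ≤ 1) (hb : 0 ≤ b)
    (hcap : ∀ k, 1 ≤ k → k ≤ K → θ ≤ a k → (1 - x) * a k ≤ a (k - 1)) (hhi : hi ≤ K) (hstart : b ≤ a hi) :
    ∀ m, m ≤ hi → θ ≤ b * (1 - x) ^ m → b * (1 - x) ^ m ≤ a (hi - m) := by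
  intro m
  induction m with
  | zero => intro _ _; simpa using hstart
  | succ m ih =>
    intro hm hθ
    have h1x : 0 ≤ 1 - x := sub_nonneg.2 hx1
    have hθ' : θ ≤ b * (1 - x) ^ m :=
      hθ.trans (by rw [pow_succ, ← mul_assoc]; exact mul_le_of_le_one_right (by positivity) (by linarith))
    have ihm := ih (Nat.le_of_succ_le hm) hθ'
    have hk1 : 1 ≤ hi - m := by omega
    have hkK : hi - m ≤ K := le_trans (Nat.sub_le _ _) hhi
    have hstep := hcap (hi - m) hk1 hkK (hθ'.trans ihm)
    have e : hi - m - 1 = hi - (m + 1) := by omega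
    rw [e] at hstep
    calc b * (1 - x) ^ (m + 1) = (1 - x) * (b * (1 - x) ^ m) := by ring
      _ ≤ (1 - x) * a (hi - m) := mul_le_mul_of_nonneg_left ihm h1x
      _ ≤ a (hi - (m + 1)) := hstep

/-- LAW PHASE: guarded law steps `a (k-1) ≥ a k − d k · a k − w k` down from `hi` to `lo`; the running bound
`2θ(1 − spent)` never drops below `θ`, which converts the absolute term `w k` into the relative `w k / θ`. -/
theorem law_steps {a d w : ℕ → ℝ} {θ : ℝ} {lo hi : ℕ} (hθ : 0 < θ) (hd : ∀ k, 0 ≤ d k) (hw : ∀ k, 0 ≤ w k)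
    (hlaw : ∀ k, lo < k → k ≤ hi → θ ≤ a k → a k - d k * a k - w k ≤ a (k - 1)) (hstart : 2 * θ ≤ a hi)
    (hbudget : ∑ k ∈ Finset.Ioc lo hi, (d k + w k / θ) ≤ 1 / 2) :
    ∀ m, m ≤ hi - lo → 2 * θ * (1 - ∑ k ∈ Finset.Ioc (hi - m) hi, (d k + w k / θ)) ≤ a (hi - m) := by
  intro m
  induction m with
  | zero => intro _; simpa using hstart
  | succ m ih =>
    intro hm
    have ihm := ih (by omega)
    set s : ℝ := ∑ k ∈ Finset.Ioc (hi - m) hi, (d k + w k / θ) with hs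
    have hsub : Finset.Ioc (hi - m) hi ⊆ Finset.Ioc lo hi :=
      Finset.Ioc_subset_Ioc (by omega) le_rfl
    have hnn : ∀ k ∈ Finset.Ioc lo hi, 0 ≤ d k + w k / θ := fun k _ => by
      have := hd k; have := hw k; positivity
    have hs_le : s ≤ 1 / 2 := (Finset.sum_le_sum_of_subset_of_nonneg hsub fun k hk _ => hnn k hk).trans hbudget
    have hs0 : 0 ≤ s := Finset.sum_nonneg fun k hk => hnn k (hsub hk)
    -- the current level
    set k := hi - m with hk
    have hklo : lo < k := by omega
    have hkhi : k ≤ hi := Nat.sub_le _ _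
    have hguard : θ ≤ a k := le_trans (by nlinarith) ihm
    have hstep := hlaw k hklo hkhi hguard
    have hkm : hi - (m + 1) = k - 1 := by omega
    -- the new spent sum
    have hins : Finset.Ioc (hi - (m + 1)) hi = insert k (Finset.Ioc (hi - m) hi) := by
      ext j; simp only [Finset.mem_Ioc, Finset.mem_insert]; omega
    have hnot : k ∉ Finset.Ioc (hi - m) hi := by simp [Finset.mem_Ioc, hk]
    rw [hins, Finset.sum_insert hnot, hkm]
    have hdk : d k ≤ 1 / 2 := by
      have hmem : k ∈ Finset.Ioc lo hi := Finset.mem_Ioc.2 ⟨hklo, hkhi⟩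
      have h1 := Finset.single_le_sum hnn hmem
      have : w k / θ ≥ 0 := by have := hw k; positivity
      linarith [h1.trans hbudget]
    have hdk0 := hd k
    have hwk0 := hw k
    -- 2θ(1 − (d k + w k/θ + s)) = 2θ(1−s) − 2θ d k − 2 w k ≤ a k − d k a k − w k ≤ a (k−1)
    have hrw : 2 * θ * (1 - (d k + w k / θ + s)) = 2 * θ * (1 - s) - 2 * θ * d k - 2 * w k := by
      field_simp; ring
    calc 2 * θ * (1 - (d k + w k / θ + s))
        = 2 * θ * (1 - s) - 2 * θ * d k - 2 * w k := hrw
      _ ≤ a k - d k * a k - w k := by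
          have h1d : 0 ≤ 1 - d k := by linarith
          nlinarith [mul_nonneg (sub_nonneg.2 ihm) h1d, mul_nonneg (mul_nonneg hθ.le hs0) hdk0, hwk0]
      _ ≤ a (k - 1) := hstep

/-- Reflected geometric tail: `Σ_{k ∈ Ioc lo hi} q^(K−k) ≤ q^(K−hi)/(1−q)` for `hi ≤ K`. -/
theorem sum_Ioc_pow_sub_le {q : ℝ} (hq0 : 0 ≤ q) (hq1 : q < 1) {K lo hi : ℕ} (hhi : hi ≤ K) :
    ∑ k ∈ Finset.Ioc lo hi, q ^ (K - k) ≤ q ^ (K - hi) / (1 - q) := by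
  have h := geom_sum_Ico_le_of_lt_one (m := K - hi) (n := K - lo) hq0 hq1
  refine le_trans (le_of_eq ?_) h
  refine Finset.sum_nbij' (fun k => K - k) (fun j => K - j) ?_ ?_ ?_ ?_ ?_
  · intro k hk; simp only [Finset.mem_Ioc] at hk; simp only [Finset.mem_Ico]; omega
  · intro j hj; simp only [Finset.mem_Ico] at hj; simp only [Finset.mem_Ioc]; omega
  · intro k hk; simp only [Finset.mem_Ioc] at hk; omega
  · intro j hj; simp only [Finset.mem_Ico] at hj; omega
  · intro k hk; rfl

/-- Geometric tail: `Σ_{k ∈ Ioc lo hi} q^k ≤ q^(lo+1)/(1−q)`. -/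
theorem sum_Ioc_pow_le {q : ℝ} (hq0 : 0 ≤ q) (hq1 : q < 1) (lo hi : ℕ) :
    ∑ k ∈ Finset.Ioc lo hi, q ^ k ≤ q ^ (lo + 1) / (1 - q) := by
  have h := geom_sum_Ico_le_of_lt_one (m := lo + 1) (n := hi + 1) hq0 hq1
  refine le_trans (le_of_eq ?_) h
  have : Finset.Ioc lo hi = Finset.Ico (lo + 1) (hi + 1) := by
    ext j; simp only [Finset.mem_Ioc, Finset.mem_Ico]; omega
  rw [this]

end RealCascade

end Summit.AtomisticToContinuum.BoseEinsteinCondensation.Theorems.NumberPhaseSandwichSandwichAlgebra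

end
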